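import Summits.CriticalPhenomena.PercolationContinuityZ3.Theorems.PercNearOneGluingNoHeavyLowerTailAntitheticDomAnchor
import Summits.CriticalPhenomena.PercolationContinuityZ3.Theorems.PercNearOneGluingNoHeavyLowerTailAntitheticTopCommonNbr
import HarnessLib

/-!
# `NoHeavyLowerTail` (stmt-CriticalPhenomena-4575) — antithetic cluster pairs: **ANCHOR BOXES WITH PRIVATE NEIGHBOURS OF THE SOURCE**
# — tools for THEOREM PR (the red-private part of the top event at EVERY target; prim-hp-2 gen 75, HOME/THEOREM-PRIV.md §2)

Support file (`--supports stmt-CriticalPhenomena-4575`, hull-port prover `prim-hp-2`, gen 75).  No definitions, no named facts, no sorries;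
standard axioms.  Notation of …AntitheticDomAnchor: colourings `T ⊆ Sym2 V`, `X T = openCluster (T ∩ E) s`, `Y T = openCluster (Tᶜ ∩ E) s`;
`s ≠ P`, `sP ∉ E`.  A neighbour `v` of `s` is COMMON if `Pv ∈ E` and PRIVATE otherwise; THEOREM TWD (…AntitheticDomTopAll) is the case
without private neighbours (`hdom`).  Here the domination hypothesis is dropped and replaced by the CYLINDER condition "every private pair
`sv` is red" on the colourings considered; the lemmas of …AntitheticDomTopBoxes / …AntitheticDomAnchor go through verbatim because a red
private pair puts its neighbour into `X T` directly:
(per-vertex `noBB_of_top` / `mem_red_of_rr` for common neighbours are `Antithetic.CommonNbr.*`, …AntitheticTopCommonNbr)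
* `Antithetic.Priv.red_eq_of_add` — adding red pairs `sv` towards vertices already in `X T₀` does not change the red cluster;
* `Antithetic.Priv.dom_of_agree` — red domination of the pattern boxes when every blue-at-`s` neighbour is common;
* `Antithetic.Priv.dom_anchor` — red domination of the pulled-back blue clusters on an anchor box (`R` a set of COMMON neighbours);
* `Antithetic.Priv.top_rr_br_sum_nonneg` — the red–red top event with some blue pair at `s`, inside the cylinder, is nonnegative.
[cite: VandenbergHaggstromKahn2005, §1 p. 6 ("Harris' inequality"), §1 p. 3 (open cluster `C_s`)]
-/

noncomputable section

namespace Summit.CriticalPhenomena.PercolationContinuityZ3.Theorems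

open Literature.Probability.Percolation
open scoped Classical

namespace Antithetic

namespace Priv

variable {V : Type*}

section Clusters

variable {E : Set (Sym2 V)} {s P : V}

/-- **Adding red pairs inside the red cluster does not change it.**  `S` a set of pairs `sv` with `v ∈ X T₀`; if `T₀ ⊆ T ⊆ T₀ ∪ S` then
`X T = X T₀`. [this work] -/
theorem red_eq_of_add {S T₀ T : Set (Sym2 V)} (hS : ∀ e ∈ S, ∃ v, v ∈ openCluster (T₀ ∩ E) s ∧ e = s(s, v))
    (hT₀T : T₀ ⊆ T) (hTT₀ : T ⊆ T₀ ∪ S) : openCluster (T ∩ E) s = openCluster (T₀ ∩ E) s := by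
  apply Set.Subset.antisymm
  · refine TwoStage.Fan.cluster_subset_of_closed (mem_openCluster_self _ s) fun u w hu huw => ?_
    obtain ⟨⟨hT, hE⟩, hne⟩ := (openGraph_adj _ u w).1 huw
    rcases hTT₀ hT with h | h
    · exact Twin.mem_red_of_pair hu h hE hne
    · obtain ⟨v, hv, he⟩ := hS _ h
      have hw : w = s ∨ w = v := by
        have : w ∈ s(s, v) := by rw [← he]; exact Sym2.mem_mk_right u w
        exact Sym2.mem_iff.1 this
      rcases hw with rfl | rfl
      · exact mem_openCluster_self _ _
      · exact hv
  · exact Freeze.openCluster_mono (Set.inter_subset_inter_left E hT₀T) s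

/-- **Red domination of the pattern boxes without the domination hypothesis.**  As `Dom.dom_of_agree`, but instead of `N(s) ⊆ N(P)` only:
every neighbour `v` of `s` whose pair `sv` is BLUE in `T` is common (`hdomT`) — automatic when the private pairs are red. [this work] -/
theorem dom_of_agree {T T' : Set (Sym2 V)}
    (hdomT : ∀ v, v ≠ s → v ≠ P → s(s, v) ∈ E → s(s, v) ∉ T → s(P, v) ∈ E) (C : Set (Sym2 V))
    (hC : ∀ e ∈ C, ∃ j k, e = s(j, k) ∧ j ≠ s ∧ j ≠ P ∧ s(s, j) ∈ E ∧ k ≠ s ∧ k ≠ P ∧ s(s, k) ∈ E)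
    (hagree_s : ∀ w, (s(s, w) ∈ T' ↔ s(s, w) ∈ T))
    (hagree_P : ∀ v, v ≠ s → v ≠ P → s(s, v) ∈ E → (s(P, v) ∈ T' ↔ s(P, v) ∈ T))
    (hflip : ∀ e : Sym2 V, s ∉ e → (¬ ∃ v, v ≠ s ∧ v ≠ P ∧ s(s, v) ∈ E ∧ e = s(P, v)) → e ∉ C → (e ∈ T' ↔ e ∉ T))
    (hPX : P ∈ openCluster (T ∩ E) s)
    (hnoBB : ∀ v, v ≠ s → v ≠ P → s(s, v) ∈ E → s(s, v) ∈ T ∨ s(P, v) ∈ T) :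
    openCluster (T'ᶜ ∩ E) s ⊆ openCluster (T ∩ E) s := by
  have hN : ∀ v, v ≠ s → v ≠ P → s(s, v) ∈ E → v ∈ openCluster (T ∩ E) s := by
    intro v hvs hvP hvE
    by_cases hsv : s(s, v) ∈ T
    · exact Twin.mem_red_of_pair (mem_openCluster_self _ s) hsv hvE hvs.symm
    · rcases hnoBB v hvs hvP hvE with h | h
      · exact absurd h hsv
      · exact Twin.mem_red_of_pair hPX h (hdomT v hvs hvP hvE hsv) hvP.symm
  refine TwoStage.Fan.cluster_subset_of_closed (mem_openCluster_self _ s) fun u w hu huw => ?_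
  obtain ⟨⟨hT', hE⟩, hne⟩ := (openGraph_adj _ u w).1 huw
  by_cases hws : w = s
  · rw [hws]; exact mem_openCluster_self _ s
  by_cases hwP : w = P
  · rw [hwP]; exact hPX
  by_cases hsu : s ∈ s(u, w)
  · have hus : u = s := by
      rcases Sym2.mem_iff.1 hsu with h | h
      · exact h.symm
      · exact absurd h.symm hws
    subst hus
    exact hN w hws hwP hE
  by_cases hPv : ∃ v, v ≠ s ∧ v ≠ P ∧ s(s, v) ∈ E ∧ s(u, w) = s(P, v)
  · obtain ⟨v, hvs, hvP, hvE, huv⟩ := hPv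
    rcases Sym2.eq_iff.1 huv with ⟨-, hw⟩ | ⟨hu', hw⟩
    · rw [hw]; exact hN v hvs hvP hvE
    · exact absurd hw hwP
  by_cases hCe : s(u, w) ∈ C
  · obtain ⟨j, k, hejk, hjs, hjP, hjE, hks, hkP, hkE⟩ := hC _ hCe
    rcases Sym2.eq_iff.1 hejk with ⟨-, hw⟩ | ⟨-, hw⟩
    · rw [hw]; exact hN k hks hkP hkE
    · rw [hw]; exact hN j hjs hjP hjE
  · have hTr : s(u, w) ∈ T := by
      by_contra h
      exact hT' ((hflip _ hsu hPv hCe).2 h)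
    exact Twin.mem_red_of_pair hu hTr hE hne

/-- **Red domination on an anchor box (private neighbours red).**  `s ≠ P`; `R` a set of COMMON neighbours of `s` containing some `j`;
the box: every `E`-pair `sv` red (common AND private), `Pv` (`v` a neighbour of `s`) red iff `v ∈ R`, all other pairs free;
`S = {sv : v ∈ R}`.  If `T, T'` lie in the box and are opposite on every free pair, then `Y (T' ∖ S) ⊆ X T`. [this work] -/
theorem dom_anchor {R : Set V} (hR : ∀ v ∈ R, v ≠ s ∧ v ≠ P ∧ s(s, v) ∈ E ∧ s(P, v) ∈ E) {j : V} (hj : j ∈ R)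
    {T T' : Set (Sym2 V)}
    (hTs : ∀ v, v ≠ s → v ≠ P → s(s, v) ∈ E → s(s, v) ∈ T) (hTP : ∀ v, v ≠ s → v ≠ P → s(s, v) ∈ E → (s(P, v) ∈ T ↔ v ∈ R))
    (hT's : ∀ v, v ≠ s → v ≠ P → s(s, v) ∈ E → s(s, v) ∈ T') (hT'P : ∀ v, v ≠ s → v ≠ P → s(s, v) ∈ E → (s(P, v) ∈ T' ↔ v ∈ R))
    (hflip : ∀ e : Sym2 V, (¬ ∃ v, (v ≠ s ∧ v ≠ P ∧ s(s, v) ∈ E) ∧ (e = s(s, v) ∨ e = s(P, v))) → (e ∈ T' ↔ e ∉ T)) :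
    openCluster ((T' \ {e | ∃ v ∈ R, e = s(s, v)})ᶜ ∩ E) s ⊆ openCluster (T ∩ E) s := by
  have hPX : P ∈ openCluster (T ∩ E) s :=
    CommonNbr.mem_red_of_rr (hR j hj).1 (hR j hj).2.1 (hR j hj).2.2.1 (hR j hj).2.2.2 (hTs j (hR j hj).1 (hR j hj).2.1 (hR j hj).2.2.1)
      ((hTP j (hR j hj).1 (hR j hj).2.1 (hR j hj).2.2.1).2 hj)
  refine TwoStage.Fan.cluster_subset_of_closed (mem_openCluster_self _ s) fun u w hu huw => ?_
  obtain ⟨⟨hTb, hE⟩, hne⟩ := (openGraph_adj _ u w).1 huw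
  by_cases hT'uw : s(u, w) ∈ T'
  · have hSuw : s(u, w) ∈ {e : Sym2 V | ∃ v ∈ R, e = s(s, v)} := by
      by_contra hn
      exact hTb ⟨hT'uw, hn⟩
    obtain ⟨v, hv, he⟩ := hSuw
    have hvX : v ∈ openCluster (T ∩ E) s :=
      Twin.mem_red_of_pair (mem_openCluster_self _ s) (hTs v (hR v hv).1 (hR v hv).2.1 (hR v hv).2.2.1) (hR v hv).2.2.1
        (hR v hv).1.symm
    have hw : w = s ∨ w = v := by
      have : w ∈ s(s, v) := by rw [← he]; exact Sym2.mem_mk_right u w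
      exact Sym2.mem_iff.1 this
    rcases hw with rfl | rfl
    · exact mem_openCluster_self _ _
    · exact hvX
  · by_cases hfix : ∃ v, (v ≠ s ∧ v ≠ P ∧ s(s, v) ∈ E) ∧ (s(u, w) = s(s, v) ∨ s(u, w) = s(P, v))
    · obtain ⟨v, hv, he | he⟩ := hfix
      · exact absurd (he ▸ hT's v hv.1 hv.2.1 hv.2.2) hT'uw
      · have hvX : v ∈ openCluster (T ∩ E) s :=
          Twin.mem_red_of_pair (mem_openCluster_self _ s) (hTs v hv.1 hv.2.1 hv.2.2) hv.2.2 hv.1.symm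
        have hw : w = P ∨ w = v := by
          have : w ∈ s(P, v) := by rw [← he]; exact Sym2.mem_mk_right u w
          exact Sym2.mem_iff.1 this
        rcases hw with rfl | rfl
        · exact hPX
        · exact hvX
    · have hTr : s(u, w) ∈ T := by
        by_contra h
        exact hT'uw ((hflip _ hfix).2 h)
      exact Twin.mem_red_of_pair hu hTr hE hne

end Clusters

variable [Fintype V]

/-- **The red–red top event with some blue pair at the source, private pairs red (`K`-form).**  On EVERY finite graph, for `s, P` and
all super-odd twisted-monotone `K₁, K₂`:  `0 ≤ Σ K₁K₂(X T, Y T)` over the colourings `T` in the top event of `P` with some COMMON neighbour of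
`s` red–red, some neighbour with `sv` blue, and every PRIVATE pair `sv` (`Pv ∉ E`) red. [this work] -/
theorem top_rr_br_sum_nonneg (E : Set (Sym2 V)) (s P : V)
    {K₁ K₂ : Set V → Set V → ℝ}
    (hK₁ : ∀ ⦃A A' B B' : Set V⦄, A ⊆ A' → B' ⊆ B → K₁ A B ≤ K₁ A' B') (hso₁ : ∀ A B, 0 ≤ K₁ A B + K₁ B A)
    (hK₂ : ∀ ⦃A A' B B' : Set V⦄, A ⊆ A' → B' ⊆ B → K₂ A B ≤ K₂ A' B') (hso₂ : ∀ A B, 0 ≤ K₂ A B + K₂ B A) :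
    0 ≤ ∑ T ∈ Finset.univ.filter (fun T : Set (Sym2 V) => P ∈ openCluster (T ∩ E) s ∧ P ∉ openCluster (Tᶜ ∩ E) s ∧
        (∃ v, v ≠ s ∧ v ≠ P ∧ s(s, v) ∈ E ∧ s(P, v) ∈ E ∧ s(s, v) ∈ T ∧ s(P, v) ∈ T) ∧
        (∃ v, v ≠ s ∧ v ≠ P ∧ s(s, v) ∈ E ∧ s(s, v) ∉ T) ∧
        (∀ v, v ≠ s → v ≠ P → s(s, v) ∈ E → s(P, v) ∉ E → s(s, v) ∈ T)),
      K₁ (openCluster (T ∩ E) s) (openCluster (Tᶜ ∩ E) s) * K₂ (openCluster (T ∩ E) s) (openCluster (Tᶜ ∩ E) s) := by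
  let A : Set (Sym2 V) := {e | s ∈ e ∨ ∃ v, v ≠ s ∧ v ≠ P ∧ s(s, v) ∈ E ∧ e = s(P, v)}
  let good : Set (Sym2 V) → Prop := fun N =>
    (∃ v, v ≠ s ∧ v ≠ P ∧ s(s, v) ∈ E ∧ s(P, v) ∈ E ∧ s(s, v) ∈ N ∧ s(P, v) ∈ N) ∧
    (∀ v, v ≠ s → v ≠ P → s(s, v) ∈ E → s(s, v) ∈ N ∨ s(P, v) ∈ N) ∧
    (∃ v, v ≠ s ∧ v ≠ P ∧ s(s, v) ∈ E ∧ s(s, v) ∉ N) ∧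
    (∀ v, v ≠ s → v ≠ P → s(s, v) ∈ E → s(P, v) ∉ E → s(s, v) ∈ N)
  have hsA : ∀ v, s(s, v) ∈ A := fun v => Or.inl (Sym2.mem_mk_left s v)
  have hPA : ∀ v, v ≠ s → v ≠ P → s(s, v) ∈ E → s(P, v) ∈ A := fun v hvs hvP hvE => Or.inr ⟨v, hvs, hvP, hvE, rfl⟩
  have hgood_iff : ∀ N M : Set (Sym2 V), (∀ e ∈ A, (e ∈ M ↔ e ∈ N)) → (good N ↔ good M) := by
    intro N M h
    constructor
    · rintro ⟨⟨v, hvs, hvP, hvE, hPvE, h1, h2⟩, hno, ⟨w, hws, hwP, hwE, hw⟩, hcyl⟩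
      exact ⟨⟨v, hvs, hvP, hvE, hPvE, (h _ (hsA v)).2 h1, (h _ (hPA v hvs hvP hvE)).2 h2⟩,
        fun v hvs hvP hvE => (hno v hvs hvP hvE).imp (h _ (hsA v)).2 (h _ (hPA v hvs hvP hvE)).2,
        ⟨w, hws, hwP, hwE, fun h' => hw ((h _ (hsA w)).1 h')⟩,
        fun v hvs hvP hvE hPvE => (h _ (hsA v)).2 (hcyl v hvs hvP hvE hPvE)⟩
    · rintro ⟨⟨v, hvs, hvP, hvE, hPvE, h1, h2⟩, hno, ⟨w, hws, hwP, hwE, hw⟩, hcyl⟩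
      exact ⟨⟨v, hvs, hvP, hvE, hPvE, (h _ (hsA v)).1 h1, (h _ (hPA v hvs hvP hvE)).1 h2⟩,
        fun v hvs hvP hvE => (hno v hvs hvP hvE).imp (h _ (hsA v)).1 (h _ (hPA v hvs hvP hvE)).1,
        ⟨w, hws, hwP, hwE, fun h' => hw ((h _ (hsA w)).2 h')⟩,
        fun v hvs hvP hvE hPvE => (h _ (hsA v)).1 (hcyl v hvs hvP hvE hPvE)⟩
  let C := {N : Set (Sym2 V) // N ⊆ A ∧ good N}
  let D : Finset (Set (Sym2 V)) := Finset.univ.filter fun T => good T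
  have hfreeze := Box.freeze_boxes_sum_nonneg E s D (fun _ : C => A) (fun c : C => c.1)
    (fun T hT => ?_) (fun c T hT => ?_) (fun c c' T hc hc' => ?_) (fun c T T' hT hT' hflip => ?_) {P} hK₁ hso₁ hK₂ hso₂
  · have hev : D.filter (fun T => ∀ Q ∈ ({P} : Set V), Q ∉ openCluster (Tᶜ ∩ E) s) =
        Finset.univ.filter (fun T : Set (Sym2 V) => P ∈ openCluster (T ∩ E) s ∧ P ∉ openCluster (Tᶜ ∩ E) s ∧
          (∃ v, v ≠ s ∧ v ≠ P ∧ s(s, v) ∈ E ∧ s(P, v) ∈ E ∧ s(s, v) ∈ T ∧ s(P, v) ∈ T) ∧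
          (∃ v, v ≠ s ∧ v ≠ P ∧ s(s, v) ∈ E ∧ s(s, v) ∉ T) ∧
          (∀ v, v ≠ s → v ≠ P → s(s, v) ∈ E → s(P, v) ∉ E → s(s, v) ∈ T)) := by
      ext T
      simp only [D, Finset.mem_filter, Finset.mem_univ, true_and, Set.mem_singleton_iff, forall_eq]
      constructor
      · rintro ⟨⟨⟨v, hvs, hvP, hvE, hPvE, h1, h2⟩, -, hbr, hcyl⟩, hPY⟩
        exact ⟨CommonNbr.mem_red_of_rr hvs hvP hvE hPvE h1 h2, hPY, ⟨v, hvs, hvP, hvE, hPvE, h1, h2⟩, hbr, hcyl⟩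
      · rintro ⟨-, hPY, ⟨v, hvs, hvP, hvE, hPvE, h1, h2⟩, hbr, hcyl⟩
        refine ⟨⟨⟨v, hvs, hvP, hvE, hPvE, h1, h2⟩, fun w hws hwP hwE => ?_, hbr, hcyl⟩, hPY⟩
        by_cases hPwE : s(P, w) ∈ E
        · exact CommonNbr.noBB_of_top hPY hws hwP hwE hPwE
        · exact Or.inl (hcyl w hws hwP hwE hPwE)
    rw [← hev]
    exact hfreeze
  · have hgT : good T := (Finset.mem_filter.1 hT).2
    refine ⟨⟨T ∩ A, Set.inter_subset_right, (hgood_iff T (T ∩ A) fun e he => ⟨fun h => h.1, fun h => ⟨h, he⟩⟩).1 hgT⟩,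
      fun e he => ⟨fun h => ⟨h, he⟩, fun h => h.1⟩⟩
  · exact Finset.mem_filter.2 ⟨Finset.mem_univ _, (hgood_iff c.1 T hT).1 c.2.2⟩
  · apply Subtype.ext
    ext e
    constructor
    · intro he
      exact (hc' e (c.2.1 he)).1 ((hc e (c.2.1 he)).2 he)
    · intro he
      exact (hc e (c'.2.1 he)).1 ((hc' e (c'.2.1 he)).2 he)
  · have hgT : good T := (hgood_iff c.1 T hT).1 c.2.2
    obtain ⟨⟨v, hvs, hvP, hvE, hPvE, h1, h2⟩, hnoBB, -, hcyl⟩ := hgT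
    refine dom_of_agree (fun w hws hwP hwE hsw => ?_) ∅ (fun e he => absurd he (Set.notMem_empty e)) (fun w => ?_)
      (fun w hws hwP hwE => ?_) (fun e hse hPe _ => hflip e ?_) (CommonNbr.mem_red_of_rr hvs hvP hvE hPvE h1 h2) hnoBB
    · by_contra hPwE
      exact hsw (hcyl w hws hwP hwE hPwE)
    · exact (hT' _ (hsA w)).trans (hT _ (hsA w)).symm
    · exact (hT' _ (hPA w hws hwP hwE)).trans (hT _ (hPA w hws hwP hwE)).symm
    · rintro (h | h)
      · exact hse h
      · exact hPe h

end Priv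

end Antithetic

end Summit.CriticalPhenomena.PercolationContinuityZ3.Theorems
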